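import Literature.MathematicalPhysics.QuantumFieldTheory.AbelianTorusCochainsDegreeThree
import HarnessLib

/-!
# Local filling of a small closed `3`-cochain on the `4`-torus, cluster form

Companion of `AbelianTorusCochainsDegreeThree.lean` (`LatticeForm.exists_td₂_eq_of_liftBox₃_shift`:
a closed `A`-valued `3`-cochain on `(ℤ/Lℤ)⁴` supported in a translate of a box away from the seam
is `td₂` of an alternating `2`-cochain supported near the box), in the box-free form consumed by
the monopole-corrected 't Hooft flux labelling: the monopole current `m = td₂ c` of a cell-label
cochain `c` is split into its clusters (restrictions to the connected components of the set of
base points of its non-zero cells under torus sup-distance `≤ 1`), each cluster of small diameter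
is filled locally, and the local fillings are subtracted from `c`.

* `LatticeForm.exists_td₂_eq_of_diam₃` (**filling one small cluster**): if `m` is closed on the
  `4`-cells and any two base points of non-zero increasing-triple components of `m` are within
  torus sup-distance `R` (`|valMinAbs|` coordinatewise), `2R + 6 ≤ L`, then `m = td₂ ω` on the
  increasing triples for an alternating `ω` every non-zero plaquette of which has its base point
  within torus sup-distance `R + 2` of the base point of a non-zero cell of `m`. (Translate a
  non-zero cell to canonical coordinates `R + 3` and apply the box statement with
  `[a, b] = [3, 2R + 3]`.) The statement mentions only `m` and `R`, so a choice of such an `ω` is a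
  function of the cluster `m` alone.
* `LatticeForm.closed₃_of_siteSaturated` (**clusters of a closed current are closed**): if `m` is
  closed and `Y` is a set of sites such that every site carrying a non-zero cell of `m` at torus
  sup-distance `≤ 1` from a site of `Y` carrying a non-zero cell lies in `Y` (e.g. a connected
  component of the support sites under sup-distance `≤ 1`), then the restriction `m_Y` of `m` to
  the cells based in `Y` is closed: every `4`-cell sees either `m_Y = m` or `m_Y = 0` on all of its
  eight faces, whose base points lie in `y + {0, 1}⁴`.
* `LatticeForm.closed₃_of_labelling`: the same for the pieces of `m` cut out by a labelling of the
  sites constant on adjacent support sites (e.g. the connected component);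
  `LatticeForm.reflTransGen_iff_exists_fin`: clusters (reflexive-transitive closure) versus the
  chains `Fin (k + 1) → _` of the bad-event clause.
* `LatticeForm.natAbs_valMinAbs_sub_le_of_reflTransGen` (**no long bad chain ⇒ small clusters**):
  if every support site has a bad plaquette within sup-distance `1` and there is no chain of bad
  plaquettes with steps `≤ 3` and extent `≥ S/16` (the bad-event clause verbatim), then support
  sites in one cluster are within sup-distance `S/16 + 2`.
* `LatticeForm.torusSiteLift_sub_eq_valMinAbs_add`, `LatticeForm.valMinAbs_sub_eq_torusSiteLift_sub`:
  the dictionary between torus sup-distance to a point `y₀` and canonical coordinates after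
  translating `y₀` into the interior of the fundamental domain.

Everything is proved; no definition and no named fact is introduced.

## References

* J. Fröhlich, T. Spencer, *Massless phases and symmetry restoration in abelian gauge theories
  and spin systems*, Comm. Math. Phys. 83 (1982) 411–454, §2.3 Lemma 1 (Poincaré lemma with
  supports). [FrohlichSpencerCMP1982]
* M. P. Forsström, *Decay of correlations in finite Abelian lattice gauge theories*, Comm. Math.
  Phys. 393 (2022), §1.3, §2 (connected components of closed forms are closed). [Forsstrom2022]
-/

set_option autoImplicit false

open Finset Function

namespace Literature.MathematicalPhysics.QuantumFieldTheory

namespace LatticeForm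

variable {L : ℕ} {A : Type*} [AddCommGroup A]

/-- `|valMinAbs 1| ≤ 1` in `ℤ/Lℤ`, for every `L` (including the degenerate `L = 0, 1`). [folklore] -/
theorem natAbs_valMinAbs_one_le (L : ℕ) : ((1 : ZMod L).valMinAbs).natAbs ≤ 1 := by
  rcases L with _ | L
  · simp
  · rcases L with _ | L
    · rw [Subsingleton.elim (1 : ZMod 1) 0, ZMod.valMinAbs_zero]; simp
    · have h : ((1 : ℕ) : ZMod (L + 2)).valMinAbs = (1 : ℕ) :=
        ZMod.valMinAbs_natCast_of_le_half (by omega)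
      rw [Nat.cast_one] at h
      rw [h]; simp

/-- Two points of a unit cube `y + {0, 1}⁴ ⊆ (ℤ/Lℤ)⁴` (the base points of the faces of the
`4`-cell at `y`) are within torus sup-distance `1`. [folklore] -/
theorem natAbs_valMinAbs_sub_le_one_of_cube {d : ℕ} (y x x' : Site d L)
    (hx : ∀ n, x n = y n ∨ x n = y n + 1) (hx' : ∀ n, x' n = y n ∨ x' n = y n + 1) (n : Fin d) :
    ((x' n - x n).valMinAbs).natAbs ≤ 1 := by
  rcases hx n with h | h <;> rcases hx' n with h' | h' <;> rw [h, h']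
  · simp
  · rw [add_sub_cancel_left]; exact natAbs_valMinAbs_one_le L
  · rw [sub_add_cancel_left, ZMod.natAbs_valMinAbs_neg]; exact natAbs_valMinAbs_one_le L
  · simp

/-- **Canonical coordinates after a translation.** If every coordinate of `y - y₀` has
`|valMinAbs| ≤ R`, then translating `y₀` to the point with all canonical coordinates `c`
(`R ≤ c`, `R + c < L`) gives `y` the canonical coordinates `valMinAbs (y n - y₀ n) + c`. [folklore] -/
theorem torusSiteLift_sub_eq_valMinAbs_add [NeZero L] {d : ℕ} (y y₀ : Site d L) (c : ℤ) {R : ℕ}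
    (h0 : (R : ℤ) ≤ c) (hL : (R : ℤ) + c < L) (n : Fin d)
    (h : ((y n - y₀ n).valMinAbs).natAbs ≤ R) :
    torusSiteLift (y - fun k => y₀ k - (c : ZMod L)) n = (y n - y₀ n).valMinAbs + c := by
  have hcoord : (y - fun k => y₀ k - (c : ZMod L)) n = (y n - y₀ n) + (c : ZMod L) := by
    simp only [Pi.sub_apply]; ring
  show ((((y - fun k => y₀ k - (c : ZMod L)) n).val : ℕ) : ℤ) = _
  have hz : y n - y₀ n + (c : ZMod L) = (((y n - y₀ n).valMinAbs + c : ℤ) : ZMod L) := by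
    rw [Int.cast_add, ZMod.coe_valMinAbs]
  rw [hcoord, hz, ZMod.val_intCast]
  exact Int.emod_eq_of_lt (by omega) (by omega)

/-- **Torus distance from canonical coordinates after a translation.** Conversely, if the
canonical coordinate `t + c` of `y` (after translating `y₀` to canonical coordinates `c`) has
`-L < 2t ≤ L`, then `valMinAbs (y n - y₀ n) = t`. [folklore] -/
theorem valMinAbs_sub_eq_torusSiteLift_sub [NeZero L] {d : ℕ} (y y₀ : Site d L) (c : ℤ) (n : Fin d)
    (h1 : -(L : ℤ) < 2 * (torusSiteLift (y - fun k => y₀ k - (c : ZMod L)) n - c))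
    (h2 : 2 * (torusSiteLift (y - fun k => y₀ k - (c : ZMod L)) n - c) ≤ L) :
    (y n - y₀ n).valMinAbs = torusSiteLift (y - fun k => y₀ k - (c : ZMod L)) n - c := by
  have hrepr : y n - y₀ n =
      (((torusSiteLift (y - fun k => y₀ k - (c : ZMod L)) n - c : ℤ)) : ZMod L) := by
    rw [Int.cast_sub]
    show _ = (((((y - fun k => y₀ k - (c : ZMod L)) n).val : ℕ) : ℤ) : ZMod L) - (c : ZMod L)
    rw [Int.cast_natCast, ZMod.natCast_zmod_val, Pi.sub_apply]; ring
  rw [ZMod.valMinAbs_spec]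
  exact ⟨hrepr, Set.mem_Ioc.2 ⟨by linarith, by linarith⟩⟩

/-- **Clusters of a closed `3`-cochain are closed.** Let `m` be a `3`-cochain on `(ℤ/Lℤ)⁴`, closed
on the `4`-cells, and let `Y` be a set of sites, *saturated* for `m` at sup-distance `1`: a site
carrying a non-zero (increasing-triple) cell of `m`, within torus sup-distance `1` of a site of `Y`
carrying a non-zero cell, lies in `Y` (e.g. `Y` a connected component of the set of such sites for
the adjacency "sup-distance `≤ 1`"). If `mY` agrees with `m` on the increasing-triple cells based
in `Y` and vanishes on those based outside `Y`, then `mY` is closed on the `4`-cells: the eight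
faces of the `4`-cell at `y` have base points in `y + {0, 1}⁴`, pairwise within sup-distance `1`, so
either `mY = m` on all of them or `mY = 0` on all of them. (Degree-three analogue of
`isClosedPl_restrictPl`.) [cite: Forsstrom2022, §1.3 (the graph of a form; components of closed forms)] -/
theorem closed₃_of_siteSaturated {m mY : Site 4 L → Fin 4 → Fin 4 → Fin 4 → A} {Y : Set (Site 4 L)}
    (hcl : ∀ y : Site 4 L, (m (y + te 0) 1 2 3 - m y 1 2 3) - (m (y + te 1) 0 2 3 - m y 0 2 3)
      + (m (y + te 2) 0 1 3 - m y 0 1 3) - (m (y + te 3) 0 1 2 - m y 0 1 2) = 0)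
    (hin : ∀ y ∈ Y, ∀ i j k : Fin 4, i < j → j < k → mY y i j k = m y i j k)
    (hout : ∀ y ∉ Y, ∀ i j k : Fin 4, i < j → j < k → mY y i j k = 0)
    (hsat : ∀ y₁ y₂ : Site 4 L, y₁ ∈ Y → (∃ i j k : Fin 4, i < j ∧ j < k ∧ m y₁ i j k ≠ 0) →
      (∃ i j k : Fin 4, i < j ∧ j < k ∧ m y₂ i j k ≠ 0) →
      (∀ n, ((y₂ n - y₁ n).valMinAbs).natAbs ≤ 1) → y₂ ∈ Y)
    (y : Site 4 L) :
    (mY (y + te 0) 1 2 3 - mY y 1 2 3) - (mY (y + te 1) 0 2 3 - mY y 0 2 3)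
      + (mY (y + te 2) 0 1 3 - mY y 0 1 3) - (mY (y + te 3) 0 1 2 - mY y 0 1 2) = 0 := by
  -- the base points of the eight faces lie in the unit cube at `y`
  have hB0 : ∀ n, y n = y n ∨ y n = y n + 1 := fun n => Or.inl rfl
  have hB : ∀ (l n : Fin 4), (y + te l : Site 4 L) n = y n ∨ (y + te l : Site 4 L) n = y n + 1 := by
    intro l n
    by_cases h : n = l
    · subst h; right; simp
    · left; simp [Pi.single_eq_of_ne h]
  have h12 : (1 : Fin 4) < 2 := by decide
  have h23 : (2 : Fin 4) < 3 := by decide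
  have h01 : (0 : Fin 4) < 1 := by decide
  have h02 : (0 : Fin 4) < 2 := by decide
  have h13 : (1 : Fin 4) < 3 := by decide
  by_cases hA : ∃ (x : Site 4 L) (i j k : Fin 4), (∀ n, x n = y n ∨ x n = y n + 1) ∧ i < j ∧ j < k ∧
      x ∈ Y ∧ m x i j k ≠ 0
  · -- a face in `Y` carries a non-zero cell: `mY = m` on all eight faces
    obtain ⟨x₁, i₁, j₁, k₁, hP₁, hij₁, hjk₁, hY₁, hm₁⟩ := hA
    have key : ∀ (x : Site 4 L) (i j k : Fin 4), (∀ n, x n = y n ∨ x n = y n + 1) → i < j → j < k →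
        mY x i j k = m x i j k := by
      intro x i j k hP hij hjk
      by_cases hm : m x i j k = 0
      · by_cases hx : x ∈ Y
        · exact hin x hx i j k hij hjk
        · rw [hout x hx i j k hij hjk, hm]
      · exact hin x (hsat x₁ x hY₁ ⟨i₁, j₁, k₁, hij₁, hjk₁, hm₁⟩ ⟨i, j, k, hij, hjk, hm⟩
          (natAbs_valMinAbs_sub_le_one_of_cube y x₁ x hP₁ hP)) i j k hij hjk
    rw [key _ 1 2 3 (hB 0) h12 h23, key _ 1 2 3 hB0 h12 h23, key _ 0 2 3 (hB 1) h02 h23,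
      key _ 0 2 3 hB0 h02 h23, key _ 0 1 3 (hB 2) h01 h13, key _ 0 1 3 hB0 h01 h13,
      key _ 0 1 2 (hB 3) h01 h12, key _ 0 1 2 hB0 h01 h12]
    exact hcl y
  · -- no face in `Y` carries a non-zero cell: `mY = 0` on all eight faces
    push Not at hA
    have key : ∀ (x : Site 4 L) (i j k : Fin 4), (∀ n, x n = y n ∨ x n = y n + 1) → i < j → j < k →
        mY x i j k = 0 := by
      intro x i j k hP hij hjk
      by_cases hx : x ∈ Y
      · rw [hin x hx i j k hij hjk]; exact hA x i j k hP hij hjk hx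
      · exact hout x hx i j k hij hjk
    rw [key _ 1 2 3 (hB 0) h12 h23, key _ 1 2 3 hB0 h12 h23, key _ 0 2 3 (hB 1) h02 h23,
      key _ 0 2 3 hB0 h02 h23, key _ 0 1 3 (hB 2) h01 h13, key _ 0 1 3 hB0 h01 h13,
      key _ 0 1 2 (hB 3) h01 h12, key _ 0 1 2 hB0 h01 h12]
    simp

/-- **Filling one small cluster of a closed `3`-cochain on the `4`-torus.** Let `m` be an
`A`-valued `3`-cochain on `(ℤ/Lℤ)⁴`, closed on the `4`-cells, such that the base points of any two
non-zero increasing-triple components are within torus sup-distance `R`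
(`|valMinAbs (y n - y' n)| ≤ R` for all `n`), where `2R + 6 ≤ L`. Then `m = td₂ ω` on the
increasing triples for an alternating `2`-cochain `ω` each of whose non-zero plaquettes has base
point within torus sup-distance `R + 2` of the base point of a non-zero cell of `m`. (Translate a
non-zero cell to canonical coordinates `R + 3`; the support then has canonical coordinates in
`[3, 2R + 3] ⊆ [3, L - 3]`; apply `exists_td₂_eq_of_liftBox₃_shift`.) In the `sup` form:
`Finset.univ.sup (fun n => ((y n - y' n).valMinAbs).natAbs) ≤ R` iff the coordinatewise bounds,
by `Finset.sup_le_iff`. [cite: FrohlichSpencerCMP1982, §2.3 Lemma 1 p. 421 (Poincaré lemma with supports)] -/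
theorem exists_td₂_eq_of_diam₃ [NeZero L] {m : Site 4 L → Fin 4 → Fin 4 → Fin 4 → A} (R : ℕ)
    (hL : 2 * R + 6 ≤ L)
    (hcl : ∀ y : Site 4 L, (m (y + te 0) 1 2 3 - m y 1 2 3) - (m (y + te 1) 0 2 3 - m y 0 2 3)
      + (m (y + te 2) 0 1 3 - m y 0 1 3) - (m (y + te 3) 0 1 2 - m y 0 1 2) = 0)
    (hdiam : ∀ (y : Site 4 L) (i j k : Fin 4) (y' : Site 4 L) (i' j' k' : Fin 4), i < j → j < k →
      i' < j' → j' < k' → m y i j k ≠ 0 → m y' i' j' k' ≠ 0 →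
      ∀ n, ((y n - y' n).valMinAbs).natAbs ≤ R) :
    ∃ ω : Site 4 L → Fin 4 → Fin 4 → A, IsAlt ω ∧
      (∀ y (i j k : Fin 4), i < j → j < k → td₂ ω y i j k = m y i j k) ∧
      ∀ y i j, ω y i j ≠ 0 → ∃ (y' : Site 4 L) (i' j' k' : Fin 4), i' < j' ∧ j' < k' ∧
        m y' i' j' k' ≠ 0 ∧ ∀ n, ((y n - y' n).valMinAbs).natAbs ≤ R + 2 := by
  classical
  by_cases hne : ∃ (y₀ : Site 4 L) (i₀ j₀ k₀ : Fin 4), i₀ < j₀ ∧ j₀ < k₀ ∧ m y₀ i₀ j₀ k₀ ≠ 0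
  swap
  · -- `m = 0` on the increasing triples: take `ω = 0`
    push Not at hne
    refine ⟨0, ⟨fun _ _ _ => by simp, fun _ _ => by simp⟩, fun y i j k hij hjk => ?_,
      fun y i j h => absurd rfl h⟩
    rw [hne y i j k hij hjk]
    simp [td₂]
  obtain ⟨y₀, i₀, j₀, k₀, hi₀, hj₀, h₀⟩ := hne
  -- translate `y₀` to canonical coordinates `c = R + 3`: the support lands in `[3, 2R + 3]`
  obtain ⟨c, hc⟩ : ∃ c : ℤ, c = R + 3 := ⟨_, rfl⟩
  have hsupp : ∀ (y : Site 4 L) (i j k : Fin 4), i < j → j < k → m y i j k ≠ 0 →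
      torusSiteLift (y - fun n => y₀ n - (c : ZMod L)) ∈
        Set.Icc (fun _ => (3 : ℤ)) (fun _ => (2 * R + 3 : ℤ)) := by
    intro y i j k hij hjk h
    have hR := hdiam y i j k y₀ i₀ j₀ k₀ hij hjk hi₀ hj₀ h h₀
    refine ⟨fun n => ?_, fun n => ?_⟩
    · show (3 : ℤ) ≤ torusSiteLift _ n
      rw [torusSiteLift_sub_eq_valMinAbs_add y y₀ c (R := R) (by omega) (by omega) n (hR n)]
      have := hR n; omega
    · show torusSiteLift _ n ≤ 2 * R + 3
      rw [torusSiteLift_sub_eq_valMinAbs_add y y₀ c (R := R) (by omega) (by omega) n (hR n)]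
      have := hR n; omega
  obtain ⟨ω, hω, htd, hsuppω⟩ := exists_td₂_eq_of_liftBox₃_shift (fun n => y₀ n - (c : ZMod L))
    (fun _ => le_rfl) (fun _ => by omega) hcl hsupp
  refine ⟨ω, hω, htd, fun y i j h => ⟨y₀, i₀, j₀, k₀, hi₀, hj₀, h₀, fun n => ?_⟩⟩
  obtain ⟨h1, h2⟩ := hsuppω y i j h
  have h1n := h1 n
  have h2n := h2 n
  simp only [Pi.sub_apply, Pi.add_apply, Pi.ofNat_apply] at h1n h2n
  rw [valMinAbs_sub_eq_torusSiteLift_sub y y₀ c n (by omega) (by omega)]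
  omega

/-- **Labelled pieces of a closed `3`-cochain are closed.** If `κ` labels the sites of
`(ℤ/Lℤ)⁴` so that two sites carrying non-zero (increasing-triple) cells of the closed `3`-cochain
`m` at torus sup-distance `≤ 1` get the same label (e.g. `κ y` = the connected component of `y` in
the support sites under sup-distance `≤ 1`), then the piece `m_c` of `m` on the sites labelled
`c` (agreeing with `m` there, zero on the other increasing-triple cells) is closed; and trivially
`m = ∑_c m_c` on the increasing triples. (`closed₃_of_siteSaturated` with `Y = κ⁻¹{c}`.)
[cite: Forsstrom2022, §1.3 (the graph of a form; components of closed forms)] -/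
theorem closed₃_of_labelling {ι : Type*} (κ : Site 4 L → ι) (c : ι)
    {m mc : Site 4 L → Fin 4 → Fin 4 → Fin 4 → A}
    (hcl : ∀ y : Site 4 L, (m (y + te 0) 1 2 3 - m y 1 2 3) - (m (y + te 1) 0 2 3 - m y 0 2 3)
      + (m (y + te 2) 0 1 3 - m y 0 1 3) - (m (y + te 3) 0 1 2 - m y 0 1 2) = 0)
    (hin : ∀ y, κ y = c → ∀ i j k : Fin 4, i < j → j < k → mc y i j k = m y i j k)
    (hout : ∀ y, κ y ≠ c → ∀ i j k : Fin 4, i < j → j < k → mc y i j k = 0)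
    (hκ : ∀ y y' : Site 4 L, (∃ i j k : Fin 4, i < j ∧ j < k ∧ m y i j k ≠ 0) →
      (∃ i j k : Fin 4, i < j ∧ j < k ∧ m y' i j k ≠ 0) →
      (∀ n, ((y' n - y n).valMinAbs).natAbs ≤ 1) → κ y = κ y')
    (y : Site 4 L) :
    (mc (y + te 0) 1 2 3 - mc y 1 2 3) - (mc (y + te 1) 0 2 3 - mc y 0 2 3)
      + (mc (y + te 2) 0 1 3 - mc y 0 1 3) - (mc (y + te 3) 0 1 2 - mc y 0 1 2) = 0 :=
  closed₃_of_siteSaturated (Y := {y | κ y = c}) hcl (fun y hy => hin y hy) (fun y hy => hout y hy)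
    (fun y₁ y₂ h₁ N₁ N₂ hd => by
      show κ y₂ = c
      rw [← hκ y₁ y₂ N₁ N₂ hd]
      exact h₁) y

omit [AddCommGroup A] in
/-- **Chains as `Fin`-tuples.** `ReflTransGen r a b` iff there is a tuple `f : Fin (k + 1) → α`
from `a` to `b` with `r`-related consecutive entries — the dictionary between connected clusters
(reflexive-transitive closure of an adjacency) and the chains `ch : Fin (k + 1) → _` with bounded
steps of the bad-event clause of the sector labelling. [folklore] -/
theorem reflTransGen_iff_exists_fin {α : Type*} {r : α → α → Prop} {a b : α} :
    Relation.ReflTransGen r a b ↔ ∃ (k : ℕ) (f : Fin (k + 1) → α), f 0 = a ∧ f (Fin.last k) = b ∧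
      ∀ i : Fin k, r (f i.castSucc) (f i.succ) := by
  constructor
  · intro h
    induction h with
    | refl => exact ⟨0, fun _ => a, rfl, rfl, fun i => i.elim0⟩
    | @tail b' c' _ hbc ih =>
      obtain ⟨k, f, h0, hlast, hstep⟩ := ih
      refine ⟨k + 1, Fin.snoc f c', ?_, ?_, fun i => ?_⟩
      · have e : (0 : Fin (k + 2)) = Fin.castSucc (0 : Fin (k + 1)) := rfl
        rw [e, Fin.snoc_castSucc, h0]
      · rw [Fin.snoc_last]
      · refine Fin.lastCases ?_ (fun j => ?_) i
        · rw [Fin.snoc_castSucc, Fin.succ_last, Fin.snoc_last, hlast]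
          exact hbc
        · rw [Fin.snoc_castSucc, Fin.succ_castSucc, Fin.snoc_castSucc]
          exact hstep j
  · rintro ⟨k, f, h0, hlast, hstep⟩
    induction k generalizing b with
    | zero =>
      rw [← hlast, ← h0, Fin.last_zero]
    | succ k ih =>
      have h0' : (fun i : Fin (k + 1) => f i.castSucc) 0 = a := by
        show f (Fin.castSucc 0) = a
        rw [Fin.castSucc_zero]
        exact h0
      have hstep' : ∀ i : Fin k, r ((fun i : Fin (k + 1) => f i.castSucc) i.castSucc)
          ((fun i : Fin (k + 1) => f i.castSucc) i.succ) := by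
        intro i
        have := hstep i.castSucc
        rwa [Fin.succ_castSucc] at this
      have hlast' : r (f (Fin.last k).castSucc) b := by
        have := hstep (Fin.last k)
        rwa [Fin.succ_last, hlast] at this
      exact (ih (fun i => f i.castSucc) h0' rfl hstep').tail hlast'

omit [AddCommGroup A] in
/-- Triangle inequality for the torus coordinate distance `|valMinAbs (a - c)|`. [folklore] -/
theorem natAbs_valMinAbs_sub_le_add (a b c : ZMod L) :
    ((a - c).valMinAbs).natAbs ≤ ((a - b).valMinAbs).natAbs + ((b - c).valMinAbs).natAbs := by
  have h : a - c = (a - b) + (b - c) := by ring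
  rw [h]
  exact (ZMod.natAbs_valMinAbs_add_le _ _).trans (Int.natAbs_add_le _ _)

omit [AddCommGroup A] in
/-- Symmetry of the torus coordinate distance. [folklore] -/
theorem natAbs_valMinAbs_sub_comm (a b : ZMod L) :
    ((a - b).valMinAbs).natAbs = ((b - a).valMinAbs).natAbs := by
  rw [← neg_sub, ZMod.natAbs_valMinAbs_neg]

omit [AddCommGroup A] in
/-- **No long bad chain ⇒ clusters of the support are small.** Abstract form of "on a good
configuration every monopole cluster has small diameter": let `bad` be a property of plaquettes
of `(ℤ/Lℤ)⁴` and `N` a property of sites (the support sites of the current) such that every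
`N`-site has a `bad` plaquette based within sup-distance `1` (each monopole cube has a bad face),
and suppose there is NO chain `ch : Fin (k + 1) → Plaquette 4 L` of bad plaquettes with
consecutive base points within sup-distance `3` and end-to-end sup-distance `≥ S/16` (the
bad-event clause of the sector labelling, verbatim). Then two `N`-sites joined by a chain of
`N`-sites with steps of sup-distance `≤ 1` (`ReflTransGen` of any such relation `r`, e.g. the
adjacency of the support graph) are within sup-distance `S/16 + 2` (bad faces along the chain form
a bad chain with steps `≤ 3`, whose extent is `< S/16`). [folklore] -/
theorem natAbs_valMinAbs_sub_le_of_reflTransGen (bad : Plaquette 4 L → Prop) (N : Site 4 L → Prop)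
    (S : ℕ)
    (hgood : ¬ ∃ (k : ℕ) (ch : Fin (k + 1) → Plaquette 4 L), (∀ i, bad (ch i)) ∧
      (∀ i : Fin k, (Finset.univ.sup fun j : Fin 4 =>
        (((ch i.castSucc).1 j - (ch i.succ).1 j).valMinAbs).natAbs) ≤ 3) ∧
      S ≤ 16 * (Finset.univ.sup fun j : Fin 4 =>
        (((ch 0).1 j - (ch (Fin.last k)).1 j).valMinAbs).natAbs))
    (hface : ∀ y, N y → ∃ p : Plaquette 4 L, bad p ∧ ∀ n, ((p.1 n - y n).valMinAbs).natAbs ≤ 1)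
    {r : Site 4 L → Site 4 L → Prop}
    (hr : ∀ a b, r a b → N a ∧ N b ∧ ∀ n, ((b n - a n).valMinAbs).natAbs ≤ 1)
    {y y' : Site 4 L} (hy : N y) (h : Relation.ReflTransGen r y y') (n : Fin 4) :
    ((y n - y' n).valMinAbs).natAbs ≤ S / 16 + 2 := by
  classical
  obtain ⟨k, f, h0, hlast, hstep⟩ := reflTransGen_iff_exists_fin.1 h
  -- every site of the chain is an `N`-site
  have hN : ∀ i : Fin (k + 1), N (f i) := by
    intro i
    refine Fin.cases ?_ (fun j => ?_) i
    · rw [h0]; exact hy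
    · exact (hr _ _ (hstep j)).2.1
  -- choose a bad plaquette near each site
  choose p hp using fun i => hface (f i) (hN i)
  -- consecutive bad plaquettes are within sup-distance `3`
  have hsteps : ∀ i : Fin k, (Finset.univ.sup fun j : Fin 4 =>
      (((p i.castSucc).1 j - (p i.succ).1 j).valMinAbs).natAbs) ≤ 3 := by
    intro i
    refine Finset.sup_le fun j _ => ?_
    have h1 := (hp i.castSucc).2 j
    have h2 := (hr _ _ (hstep i)).2.2 j
    have h3 := (hp i.succ).2 j
    rw [natAbs_valMinAbs_sub_comm] at h3
    calc (((p i.castSucc).1 j - (p i.succ).1 j).valMinAbs).natAbs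
        ≤ (((p i.castSucc).1 j - f i.castSucc j).valMinAbs).natAbs +
            ((f i.castSucc j - (p i.succ).1 j).valMinAbs).natAbs := natAbs_valMinAbs_sub_le_add _ _ _
      _ ≤ (((p i.castSucc).1 j - f i.castSucc j).valMinAbs).natAbs +
            (((f i.castSucc j - f i.succ j).valMinAbs).natAbs +
              ((f i.succ j - (p i.succ).1 j).valMinAbs).natAbs) := by
          gcongr; exact natAbs_valMinAbs_sub_le_add _ _ _
      _ ≤ 1 + (1 + 1) := by
          gcongr
          rwa [natAbs_valMinAbs_sub_comm] at h2
      _ = 3 := rfl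
  -- hence the bad chain is short
  have hshort : 16 * (Finset.univ.sup fun j : Fin 4 =>
      (((p 0).1 j - (p (Fin.last k)).1 j).valMinAbs).natAbs) < S := by
    by_contra hle
    exact hgood ⟨k, p, fun i => (hp i).1, hsteps, not_lt.1 hle⟩
  have hDn : (((p 0).1 n - (p (Fin.last k)).1 n).valMinAbs).natAbs ≤
      Finset.univ.sup fun j : Fin 4 => (((p 0).1 j - (p (Fin.last k)).1 j).valMinAbs).natAbs :=
    Finset.le_sup (f := fun j : Fin 4 => (((p 0).1 j - (p (Fin.last k)).1 j).valMinAbs).natAbs)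
      (Finset.mem_univ n)
  -- and `y`, `y'` are within `1` of its ends
  have hy0 : ((y n - (p 0).1 n).valMinAbs).natAbs ≤ 1 := by
    rw [natAbs_valMinAbs_sub_comm, ← h0]; exact (hp 0).2 n
  have hy1 : (((p (Fin.last k)).1 n - y' n).valMinAbs).natAbs ≤ 1 := by
    rw [← hlast]; exact (hp (Fin.last k)).2 n
  have htri₁ := natAbs_valMinAbs_sub_le_add (y n) ((p 0).1 n) (y' n)
  have htri₂ := natAbs_valMinAbs_sub_le_add ((p 0).1 n) ((p (Fin.last k)).1 n) (y' n)
  omega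

end LatticeForm

end Literature.MathematicalPhysics.QuantumFieldTheory
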